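import Summits.RiemannHypothesis.RiemannHypothesis.Theorems.IntegerScrewCensusDualTaylor

/-!
# Route `IntegerScrew` — kernel checker for the census DUAL certificates (5b): derivative models and the cubic step

Continuation of `IntegerScrewCensusDualTaylor`: the first- and second-derivative models of one term
(`term_deriv_err`, `term_deriv2_err`) and the one-sided third-order step of a true term (`term_step3`).
RH-free; nothing here bears on the truth of RH.
-/

set_option linter.dupNamespace false
set_option autoImplicit false

namespace Summit.RiemannHypothesis.RiemannHypothesis.Theorems.IntegerScrew.Manifest.Fast

open Finset Complex

/-! ### The first-derivative model of one term -/

/-- Shifted weight error: `Σ_{k<n} (k+1) W_{k+1} i^{k+1} σ^k = K₁ (ic)·T_n(iσc) + E₁`, `‖E₁‖ ≤ (n+1)²`. -/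
theorem weights_split1 {n K1 : ℕ} {c σ : ℝ} {W : ℕ → ℕ}
    (hW : ∀ k, k < n + 1 → |(W k : ℝ) - K1 * c ^ k / k.factorial| ≤ 1) (hσ : |σ| ≤ 1) :
    ‖(∑ k ∈ range n, ((k + 1 : ℕ) : ℂ) * (W (k + 1) : ℂ) * I ^ (k + 1) * (σ : ℂ) ^ k) -
        (K1 : ℂ) * (I * c) * texp n (I * ((σ * c : ℝ) : ℂ))‖ ≤ ((n : ℝ) + 1) ^ 2 := by
  unfold texp
  rw [Finset.mul_sum, ← Finset.sum_sub_distrib]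
  have hterm : ∀ k ∈ range n, ‖((k + 1 : ℕ) : ℂ) * (W (k + 1) : ℂ) * I ^ (k + 1) * (σ : ℂ) ^ k -
      (K1 : ℂ) * (I * c) * ((I * ((σ * c : ℝ) : ℂ)) ^ k / (k.factorial : ℂ))‖ ≤ (n : ℝ) + 1 := by
    intro k hk
    rw [Finset.mem_range] at hk
    have hk1 : ((k + 1 : ℕ) : ℝ) ≤ n + 1 := by exact_mod_cast (show k + 1 ≤ n + 1 by omega)
    have hfac : ((k + 1).factorial : ℝ) = (k + 1 : ℕ) * k.factorial := by
      rw [Nat.factorial_succ]; push_cast; ring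
    have e : (K1 : ℂ) * (I * c) * ((I * ((σ * c : ℝ) : ℂ)) ^ k / (k.factorial : ℂ)) =
        ((k + 1 : ℕ) : ℂ) * ((K1 * c ^ (k + 1) / (k + 1).factorial : ℝ) : ℂ) * I ^ (k + 1) * (σ : ℂ) ^ k := by
      have hk0 : (k : ℂ) + 1 ≠ 0 := by exact_mod_cast Nat.succ_ne_zero k
      have hf0 : ((k.factorial : ℕ) : ℂ) ≠ 0 := by exact_mod_cast (Nat.factorial_pos k).ne'
      rw [Nat.factorial_succ]
      push_cast
      field_simp
      ring
    rw [e, show ((k + 1 : ℕ) : ℂ) * (W (k + 1) : ℂ) * I ^ (k + 1) * (σ : ℂ) ^ k -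
        ((k + 1 : ℕ) : ℂ) * ((K1 * c ^ (k + 1) / (k + 1).factorial : ℝ) : ℂ) * I ^ (k + 1) * (σ : ℂ) ^ k =
        ((k + 1 : ℕ) : ℂ) * (((W (k + 1) : ℝ) : ℂ) - ((K1 * c ^ (k + 1) / (k + 1).factorial : ℝ) : ℂ)) * I ^ (k + 1) * (σ : ℂ) ^ k by
          push_cast; ring]
    rw [norm_mul, norm_mul, norm_mul, norm_pow, Complex.norm_I, one_pow, mul_one, norm_pow, Complex.norm_real,
      Complex.norm_natCast, ← Complex.ofReal_sub, Complex.norm_real, Real.norm_eq_abs, Real.norm_eq_abs]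
    have h1 := hW (k + 1) (by omega)
    have h2 : |σ| ^ k ≤ 1 := pow_le_one₀ (abs_nonneg σ) hσ
    calc ((k + 1 : ℕ) : ℝ) * |(W (k + 1) : ℝ) - K1 * c ^ (k + 1) / (k + 1).factorial| * |σ| ^ k
        ≤ ((n : ℝ) + 1) * 1 * 1 := by
          refine mul_le_mul (mul_le_mul hk1 h1 (abs_nonneg _) (by positivity)) h2 (by positivity) (by positivity)
      _ = (n : ℝ) + 1 := by ring
  calc ‖∑ k ∈ range n, (((k + 1 : ℕ) : ℂ) * (W (k + 1) : ℂ) * I ^ (k + 1) * (σ : ℂ) ^ k -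
        (K1 : ℂ) * (I * c) * ((I * ((σ * c : ℝ) : ℂ)) ^ k / (k.factorial : ℂ)))‖
      ≤ ∑ k ∈ range n, ‖((k + 1 : ℕ) : ℂ) * (W (k + 1) : ℂ) * I ^ (k + 1) * (σ : ℂ) ^ k -
        (K1 : ℂ) * (I * c) * ((I * ((σ * c : ℝ) : ℂ)) ^ k / (k.factorial : ℂ))‖ := norm_sum_le _ _
    _ ≤ ∑ k ∈ range n, ((n : ℝ) + 1) := Finset.sum_le_sum hterm
    _ = n * ((n : ℝ) + 1) := by rw [Finset.sum_const, Finset.card_range, nsmul_eq_mul]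
    _ ≤ ((n : ℝ) + 1) ^ 2 := by nlinarith

/-- **Model first-derivative error of one term**: with `ρ₁ = 2c^n/n!` (`c ≤ (n+1)/2`),
`|Re(ζ̂ Σ_{k<n} (k+1)W_{k+1} i^{k+1} σ^k) − B K₁ Re(ζ iν' e^{iσν'})| ≤ B K₁ (c δ(1+ρ₁) + cρ₁ + Δ'(1+|ν'|)) + (n+1)²‖ζ̂‖`. -/
theorem term_deriv_err {n K1 : ℕ} {B c ν' δ Δ' σ : ℝ} {W : ℕ → ℕ} {ζ ζh : ℂ} (hB : 0 ≤ B)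
    (hW : ∀ k, k < n + 1 → |(W k : ℝ) - K1 * c ^ k / k.factorial| ≤ 1) (hc0 : 0 ≤ c) (hc : c ≤ ((n : ℝ) + 1) / 2)
    (hζ : ‖ζ‖ = 1) (hζh : ‖ζh - (B : ℂ) * ζ‖ ≤ B * δ) (hν : |c - ν'| ≤ Δ') (hσ : |σ| ≤ 1) :
    |(ζh * ∑ k ∈ range n, ((k + 1 : ℕ) : ℂ) * (W (k + 1) : ℂ) * I ^ (k + 1) * (σ : ℂ) ^ k).re -
        B * K1 * (ζ * (I * ν') * exp (I * ((σ * ν' : ℝ) : ℂ))).re| ≤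
      B * K1 * (c * δ * (1 + 2 * c ^ n / n.factorial) + c * (2 * c ^ n / n.factorial) + Δ' * (1 + |ν'|)) +
        ((n : ℝ) + 1) ^ 2 * ‖ζh‖ := by
  set ρ : ℝ := 2 * c ^ n / n.factorial with hρ
  set T := texp n (I * ((σ * c : ℝ) : ℂ)) with hT
  set S := ∑ k ∈ range n, ((k + 1 : ℕ) : ℂ) * (W (k + 1) : ℂ) * I ^ (k + 1) * (σ : ℂ) ^ k with hS
  have hσc : |σ * c| ≤ c := by rw [abs_mul, abs_of_nonneg hc0]; exact mul_le_of_le_one_left hc0 hσ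
  have hE : ‖S - (K1 : ℂ) * (I * c) * T‖ ≤ ((n : ℝ) + 1) ^ 2 := weights_split1 hW hσ
  have hTe : ‖exp (I * ((σ * c : ℝ) : ℂ)) - T‖ ≤ ρ := texp_err hσc hc
  have hTn : ‖T‖ ≤ 1 + ρ := norm_texp_le hσc hc
  have hΔ0 : 0 ≤ Δ' := (abs_nonneg _).trans hν
  have hee : ‖(I * c) * exp (I * ((σ * c : ℝ) : ℂ)) - (I * ν') * exp (I * ((σ * ν' : ℝ) : ℂ))‖ ≤ Δ' * (1 + |ν'|) := by
    have e : (I * c) * exp (I * ((σ * c : ℝ) : ℂ)) - (I * ν') * exp (I * ((σ * ν' : ℝ) : ℂ)) =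
        I * ((c - ν' : ℝ) : ℂ) * exp (I * ((σ * c : ℝ) : ℂ)) +
          I * ν' * (exp (I * ((σ * c : ℝ) : ℂ)) - exp (I * ((σ * ν' : ℝ) : ℂ))) := by push_cast; ring
    rw [e]
    refine (norm_add_le _ _).trans ?_
    rw [norm_mul, norm_mul, Complex.norm_I, one_mul, Complex.norm_real, Complex.norm_exp_I_mul_ofReal, mul_one,
      norm_mul, norm_mul, Complex.norm_I, one_mul, Complex.norm_real, Real.norm_eq_abs, Real.norm_eq_abs]
    have h2 : ‖exp (I * ((σ * c : ℝ) : ℂ)) - exp (I * ((σ * ν' : ℝ) : ℂ))‖ ≤ Δ' := by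
      refine (norm_expI_sub_expI _ _).trans ?_
      rw [← mul_sub, abs_mul]
      calc |σ| * |c - ν'| ≤ 1 * Δ' := mul_le_mul hσ hν (abs_nonneg _) (by norm_num)
        _ = Δ' := one_mul _
    have := mul_le_mul_of_nonneg_left h2 (abs_nonneg ν')
    nlinarith
  have hdec : ζh * S - (B : ℂ) * (K1 : ℂ) * (ζ * (I * ν') * exp (I * ((σ * ν' : ℝ) : ℂ))) =
      (K1 : ℂ) * (I * c) * ((ζh - (B : ℂ) * ζ) * T) + (B : ℂ) * (K1 : ℂ) * (I * c) * (ζ * (T - exp (I * ((σ * c : ℝ) : ℂ)))) +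
        (B : ℂ) * (K1 : ℂ) * (ζ * ((I * c) * exp (I * ((σ * c : ℝ) : ℂ)) - (I * ν') * exp (I * ((σ * ν' : ℝ) : ℂ)))) +
        ζh * (S - (K1 : ℂ) * (I * c) * T) := by
    ring
  have hK : (0 : ℝ) ≤ K1 := Nat.cast_nonneg _
  have hBn : ‖(B : ℂ)‖ = B := by rw [Complex.norm_real, Real.norm_eq_abs, abs_of_nonneg hB]
  have hnorm : ‖ζh * S - (B : ℂ) * (K1 : ℂ) * (ζ * (I * ν') * exp (I * ((σ * ν' : ℝ) : ℂ)))‖ ≤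
      B * K1 * (c * δ * (1 + ρ) + c * ρ + Δ' * (1 + |ν'|)) + ((n : ℝ) + 1) ^ 2 * ‖ζh‖ := by
    rw [hdec]
    refine (norm_add_le _ _).trans ?_
    refine (add_le_add (norm_add_le _ _) le_rfl).trans ?_
    refine (add_le_add (add_le_add (norm_add_le _ _) le_rfl) le_rfl).trans ?_
    have t1 : ‖(K1 : ℂ) * (I * c) * ((ζh - (B : ℂ) * ζ) * T)‖ ≤ K1 * c * (B * δ * (1 + ρ)) := by
      have e : ‖(K1 : ℂ) * (I * c) * ((ζh - (B : ℂ) * ζ) * T)‖ = K1 * c * (‖ζh - (B : ℂ) * ζ‖ * ‖T‖) := by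
        simp only [norm_mul, Complex.norm_natCast, Complex.norm_I, one_mul, Complex.norm_real, Real.norm_eq_abs,
          abs_of_nonneg hc0]
      rw [e]
      exact mul_le_mul_of_nonneg_left (mul_le_mul hζh hTn (norm_nonneg _) ((norm_nonneg _).trans hζh)) (by positivity)
    have t2 : ‖(B : ℂ) * (K1 : ℂ) * (I * c) * (ζ * (T - exp (I * ((σ * c : ℝ) : ℂ))))‖ ≤ B * K1 * c * ρ := by
      have e : ‖(B : ℂ) * (K1 : ℂ) * (I * c) * (ζ * (T - exp (I * ((σ * c : ℝ) : ℂ))))‖ =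
          B * K1 * c * ‖T - exp (I * ((σ * c : ℝ) : ℂ))‖ := by
        simp only [norm_mul, Complex.norm_natCast, Complex.norm_I, one_mul, Complex.norm_real, Real.norm_eq_abs,
          abs_of_nonneg hc0, abs_of_nonneg hB, hζ]
      rw [e, norm_sub_rev]
      exact mul_le_mul_of_nonneg_left hTe (by positivity)
    have t3 : ‖(B : ℂ) * (K1 : ℂ) * (ζ * ((I * c) * exp (I * ((σ * c : ℝ) : ℂ)) - (I * ν') * exp (I * ((σ * ν' : ℝ) : ℂ))))‖ ≤
        B * K1 * (Δ' * (1 + |ν'|)) := by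
      rw [norm_mul, norm_mul, norm_mul, Complex.norm_natCast, hζ, one_mul, hBn]
      exact mul_le_mul_of_nonneg_left hee (by positivity)
    have t4 : ‖ζh * (S - (K1 : ℂ) * (I * c) * T)‖ ≤ ((n : ℝ) + 1) ^ 2 * ‖ζh‖ := by
      rw [norm_mul, mul_comm]; exact mul_le_mul_of_nonneg_right hE (norm_nonneg _)
    have := add_le_add (add_le_add (add_le_add t1 t2) t3) t4
    refine this.trans (le_of_eq ?_)
    ring
  have hre := Complex.abs_re_le_norm (ζh * S - (B : ℂ) * (K1 : ℂ) * (ζ * (I * ν') * exp (I * ((σ * ν' : ℝ) : ℂ))))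
  rw [Complex.sub_re] at hre
  have e2 : ((B : ℂ) * (K1 : ℂ) * (ζ * (I * ν') * exp (I * ((σ * ν' : ℝ) : ℂ)))).re =
      B * K1 * (ζ * (I * ν') * exp (I * ((σ * ν' : ℝ) : ℂ))).re := by
    rw [show (B : ℂ) * (K1 : ℂ) = ((B * K1 : ℝ) : ℂ) by push_cast; ring, Complex.re_ofReal_mul]
  rw [e2] at hre
  exact hre.trans hnorm

/-! ### The second-derivative model of one term -/

/-- Twice-shifted weight error: `Σ_{k<n} (k+1)(k+2) W_{k+2} i^{k+2} σ^k = K₁ (ic)²·T_n(iσc) + E₂`, `‖E₂‖ ≤ (n+2)³`. -/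
theorem weights_split2 {n K1 : ℕ} {c σ : ℝ} {W : ℕ → ℕ}
    (hW : ∀ k, k < n + 2 → |(W k : ℝ) - K1 * c ^ k / k.factorial| ≤ 1) (hσ : |σ| ≤ 1) :
    ‖(∑ k ∈ range n, ((k + 1 : ℕ) : ℂ) * ((k + 2 : ℕ) : ℂ) * (W (k + 2) : ℂ) * I ^ (k + 2) * (σ : ℂ) ^ k) -
        (K1 : ℂ) * (I * c) ^ 2 * texp n (I * ((σ * c : ℝ) : ℂ))‖ ≤ ((n : ℝ) + 2) ^ 3 := by
  unfold texp
  rw [Finset.mul_sum, ← Finset.sum_sub_distrib]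
  have hterm : ∀ k ∈ range n, ‖((k + 1 : ℕ) : ℂ) * ((k + 2 : ℕ) : ℂ) * (W (k + 2) : ℂ) * I ^ (k + 2) * (σ : ℂ) ^ k -
      (K1 : ℂ) * (I * c) ^ 2 * ((I * ((σ * c : ℝ) : ℂ)) ^ k / (k.factorial : ℂ))‖ ≤ ((n : ℝ) + 2) ^ 2 := by
    intro k hk
    rw [Finset.mem_range] at hk
    have hk1 : ((k + 1 : ℕ) : ℝ) ≤ n + 2 := by exact_mod_cast (show k + 1 ≤ n + 2 by omega)
    have hk2 : ((k + 2 : ℕ) : ℝ) ≤ n + 2 := by exact_mod_cast (show k + 2 ≤ n + 2 by omega)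
    have e : (K1 : ℂ) * (I * c) ^ 2 * ((I * ((σ * c : ℝ) : ℂ)) ^ k / (k.factorial : ℂ)) =
        ((k + 1 : ℕ) : ℂ) * ((k + 2 : ℕ) : ℂ) * ((K1 * c ^ (k + 2) / (k + 2).factorial : ℝ) : ℂ) * I ^ (k + 2) * (σ : ℂ) ^ k := by
      have hk0 : (k : ℂ) + 1 ≠ 0 := by exact_mod_cast Nat.succ_ne_zero k
      have hk0' : (k : ℂ) + 2 ≠ 0 := by
        have : ((k + 2 : ℕ) : ℂ) ≠ 0 := by exact_mod_cast Nat.succ_ne_zero (k + 1)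
        push_cast at this; exact this
      have hf0 : ((k.factorial : ℕ) : ℂ) ≠ 0 := by exact_mod_cast (Nat.factorial_pos k).ne'
      rw [show (k + 2).factorial = (k + 2) * ((k + 1) * k.factorial) by
        rw [Nat.factorial_succ, Nat.factorial_succ]]
      push_cast
      field_simp
      ring
    rw [e, show ((k + 1 : ℕ) : ℂ) * ((k + 2 : ℕ) : ℂ) * (W (k + 2) : ℂ) * I ^ (k + 2) * (σ : ℂ) ^ k -
        ((k + 1 : ℕ) : ℂ) * ((k + 2 : ℕ) : ℂ) * ((K1 * c ^ (k + 2) / (k + 2).factorial : ℝ) : ℂ) * I ^ (k + 2) * (σ : ℂ) ^ k =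
        ((k + 1 : ℕ) : ℂ) * ((k + 2 : ℕ) : ℂ) * (((W (k + 2) : ℝ) : ℂ) - ((K1 * c ^ (k + 2) / (k + 2).factorial : ℝ) : ℂ)) *
          I ^ (k + 2) * (σ : ℂ) ^ k by push_cast; ring]
    rw [norm_mul, norm_mul, norm_mul, norm_mul, norm_pow, Complex.norm_I, one_pow, mul_one, norm_pow, Complex.norm_real,
      Complex.norm_natCast, Complex.norm_natCast, ← Complex.ofReal_sub, Complex.norm_real, Real.norm_eq_abs,
      Real.norm_eq_abs]
    have h1 := hW (k + 2) (by omega)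
    have h2 : |σ| ^ k ≤ 1 := pow_le_one₀ (abs_nonneg σ) hσ
    calc ((k + 1 : ℕ) : ℝ) * ((k + 2 : ℕ) : ℝ) * |(W (k + 2) : ℝ) - K1 * c ^ (k + 2) / (k + 2).factorial| * |σ| ^ k
        ≤ ((n : ℝ) + 2) * ((n : ℝ) + 2) * 1 * 1 := by
          refine mul_le_mul (mul_le_mul (mul_le_mul hk1 hk2 (by positivity) (by positivity)) h1 (abs_nonneg _)
            (by positivity)) h2 (by positivity) (by positivity)
      _ = ((n : ℝ) + 2) ^ 2 := by ring
  calc ‖∑ k ∈ range n, (((k + 1 : ℕ) : ℂ) * ((k + 2 : ℕ) : ℂ) * (W (k + 2) : ℂ) * I ^ (k + 2) * (σ : ℂ) ^ k -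
        (K1 : ℂ) * (I * c) ^ 2 * ((I * ((σ * c : ℝ) : ℂ)) ^ k / (k.factorial : ℂ)))‖
      ≤ ∑ k ∈ range n, ‖((k + 1 : ℕ) : ℂ) * ((k + 2 : ℕ) : ℂ) * (W (k + 2) : ℂ) * I ^ (k + 2) * (σ : ℂ) ^ k -
        (K1 : ℂ) * (I * c) ^ 2 * ((I * ((σ * c : ℝ) : ℂ)) ^ k / (k.factorial : ℂ))‖ := norm_sum_le _ _
    _ ≤ ∑ k ∈ range n, ((n : ℝ) + 2) ^ 2 := Finset.sum_le_sum hterm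
    _ = n * ((n : ℝ) + 2) ^ 2 := by rw [Finset.sum_const, Finset.card_range, nsmul_eq_mul]
    _ ≤ ((n : ℝ) + 2) ^ 3 := by nlinarith [sq_nonneg ((n : ℝ) + 2)]

/-- **Model second-derivative error of one term**: with `ρ₂ = 2c^n/n!` (`c ≤ (n+1)/2`),
`|Re(ζ̂ Σ_{k<n} (k+1)(k+2)W_{k+2} i^{k+2} σ^k) − B K₁ Re(ζ (iν')² e^{iσν'})| ≤
 B K₁ (c² δ(1+ρ₂) + c²ρ₂ + Δ'(c + |ν'| + |ν'|²)) + (n+2)³‖ζ̂‖`. -/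
theorem term_deriv2_err {n K1 : ℕ} {B c ν' δ Δ' σ : ℝ} {W : ℕ → ℕ} {ζ ζh : ℂ} (hB : 0 ≤ B)
    (hW : ∀ k, k < n + 2 → |(W k : ℝ) - K1 * c ^ k / k.factorial| ≤ 1) (hc0 : 0 ≤ c) (hc : c ≤ ((n : ℝ) + 1) / 2)
    (hζ : ‖ζ‖ = 1) (hζh : ‖ζh - (B : ℂ) * ζ‖ ≤ B * δ) (hν : |c - ν'| ≤ Δ') (hσ : |σ| ≤ 1) :
    |(ζh * ∑ k ∈ range n, ((k + 1 : ℕ) : ℂ) * ((k + 2 : ℕ) : ℂ) * (W (k + 2) : ℂ) * I ^ (k + 2) * (σ : ℂ) ^ k).re -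
        B * K1 * (ζ * (I * ν') ^ 2 * exp (I * ((σ * ν' : ℝ) : ℂ))).re| ≤
      B * K1 * (c ^ 2 * δ * (1 + 2 * c ^ n / n.factorial) + c ^ 2 * (2 * c ^ n / n.factorial) +
        Δ' * (c + |ν'| + |ν'| ^ 2)) + ((n : ℝ) + 2) ^ 3 * ‖ζh‖ := by
  set ρ : ℝ := 2 * c ^ n / n.factorial with hρ
  set T := texp n (I * ((σ * c : ℝ) : ℂ)) with hT
  set S := ∑ k ∈ range n, ((k + 1 : ℕ) : ℂ) * ((k + 2 : ℕ) : ℂ) * (W (k + 2) : ℂ) * I ^ (k + 2) * (σ : ℂ) ^ k with hS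
  have hσc : |σ * c| ≤ c := by rw [abs_mul, abs_of_nonneg hc0]; exact mul_le_of_le_one_left hc0 hσ
  have hE : ‖S - (K1 : ℂ) * (I * c) ^ 2 * T‖ ≤ ((n : ℝ) + 2) ^ 3 := weights_split2 hW hσ
  have hTe : ‖exp (I * ((σ * c : ℝ) : ℂ)) - T‖ ≤ ρ := texp_err hσc hc
  have hTn : ‖T‖ ≤ 1 + ρ := norm_texp_le hσc hc
  have hΔ0 : 0 ≤ Δ' := (abs_nonneg _).trans hν
  have h2e : ‖exp (I * ((σ * c : ℝ) : ℂ)) - exp (I * ((σ * ν' : ℝ) : ℂ))‖ ≤ Δ' := by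
    refine (norm_expI_sub_expI _ _).trans ?_
    rw [← mul_sub, abs_mul]
    calc |σ| * |c - ν'| ≤ 1 * Δ' := mul_le_mul hσ hν (abs_nonneg _) (by norm_num)
      _ = Δ' := one_mul _
  have hee : ‖(I * c) ^ 2 * exp (I * ((σ * c : ℝ) : ℂ)) - (I * ν') ^ 2 * exp (I * ((σ * ν' : ℝ) : ℂ))‖ ≤
      Δ' * (c + |ν'| + |ν'| ^ 2) := by
    have e : (I * c) ^ 2 * exp (I * ((σ * c : ℝ) : ℂ)) - (I * ν') ^ 2 * exp (I * ((σ * ν' : ℝ) : ℂ)) =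
        I ^ 2 * ((c - ν' : ℝ) : ℂ) * ((c + ν' : ℝ) : ℂ) * exp (I * ((σ * c : ℝ) : ℂ)) +
          I ^ 2 * (ν' : ℂ) ^ 2 * (exp (I * ((σ * c : ℝ) : ℂ)) - exp (I * ((σ * ν' : ℝ) : ℂ))) := by push_cast; ring
    rw [e]
    refine (norm_add_le _ _).trans ?_
    rw [norm_mul, norm_mul, norm_mul, norm_pow, Complex.norm_I, one_pow, one_mul, Complex.norm_real, Complex.norm_real,
      Complex.norm_exp_I_mul_ofReal, mul_one, norm_mul, norm_mul, norm_pow, Complex.norm_I, one_pow, one_mul, norm_pow,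
      Complex.norm_real, Real.norm_eq_abs, Real.norm_eq_abs, Real.norm_eq_abs]
    have h3 : |c + ν'| ≤ c + |ν'| := (abs_add_le _ _).trans (by rw [abs_of_nonneg hc0])
    have t1 : |c - ν'| * |c + ν'| ≤ Δ' * (c + |ν'|) := mul_le_mul hν h3 (abs_nonneg _) hΔ0
    have t2 : |ν'| ^ 2 * ‖exp (I * ((σ * c : ℝ) : ℂ)) - exp (I * ((σ * ν' : ℝ) : ℂ))‖ ≤ |ν'| ^ 2 * Δ' :=
      mul_le_mul_of_nonneg_left h2e (by positivity)
    nlinarith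
  have hdec : ζh * S - (B : ℂ) * (K1 : ℂ) * (ζ * (I * ν') ^ 2 * exp (I * ((σ * ν' : ℝ) : ℂ))) =
      (K1 : ℂ) * (I * c) ^ 2 * ((ζh - (B : ℂ) * ζ) * T) + (B : ℂ) * (K1 : ℂ) * (I * c) ^ 2 * (ζ * (T - exp (I * ((σ * c : ℝ) : ℂ)))) +
        (B : ℂ) * (K1 : ℂ) * (ζ * ((I * c) ^ 2 * exp (I * ((σ * c : ℝ) : ℂ)) - (I * ν') ^ 2 * exp (I * ((σ * ν' : ℝ) : ℂ)))) +
        ζh * (S - (K1 : ℂ) * (I * c) ^ 2 * T) := by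
    ring
  have hK : (0 : ℝ) ≤ K1 := Nat.cast_nonneg _
  have hBn : ‖(B : ℂ)‖ = B := by rw [Complex.norm_real, Real.norm_eq_abs, abs_of_nonneg hB]
  have hnorm : ‖ζh * S - (B : ℂ) * (K1 : ℂ) * (ζ * (I * ν') ^ 2 * exp (I * ((σ * ν' : ℝ) : ℂ)))‖ ≤
      B * K1 * (c ^ 2 * δ * (1 + ρ) + c ^ 2 * ρ + Δ' * (c + |ν'| + |ν'| ^ 2)) + ((n : ℝ) + 2) ^ 3 * ‖ζh‖ := by
    rw [hdec]
    refine (norm_add_le _ _).trans ?_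
    refine (add_le_add (norm_add_le _ _) le_rfl).trans ?_
    refine (add_le_add (add_le_add (norm_add_le _ _) le_rfl) le_rfl).trans ?_
    have t1 : ‖(K1 : ℂ) * (I * c) ^ 2 * ((ζh - (B : ℂ) * ζ) * T)‖ ≤ K1 * c ^ 2 * (B * δ * (1 + ρ)) := by
      have e : ‖(K1 : ℂ) * (I * c) ^ 2 * ((ζh - (B : ℂ) * ζ) * T)‖ = K1 * c ^ 2 * (‖ζh - (B : ℂ) * ζ‖ * ‖T‖) := by
        simp only [norm_mul, norm_pow, Complex.norm_natCast, Complex.norm_I, one_mul, Complex.norm_real, Real.norm_eq_abs,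
          abs_of_nonneg hc0]
      rw [e]
      exact mul_le_mul_of_nonneg_left (mul_le_mul hζh hTn (norm_nonneg _) ((norm_nonneg _).trans hζh)) (by positivity)
    have t2 : ‖(B : ℂ) * (K1 : ℂ) * (I * c) ^ 2 * (ζ * (T - exp (I * ((σ * c : ℝ) : ℂ))))‖ ≤ B * K1 * c ^ 2 * ρ := by
      have e : ‖(B : ℂ) * (K1 : ℂ) * (I * c) ^ 2 * (ζ * (T - exp (I * ((σ * c : ℝ) : ℂ))))‖ =
          B * K1 * c ^ 2 * ‖T - exp (I * ((σ * c : ℝ) : ℂ))‖ := by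
        simp only [norm_mul, norm_pow, Complex.norm_natCast, Complex.norm_I, one_mul, Complex.norm_real, Real.norm_eq_abs,
          abs_of_nonneg hc0, abs_of_nonneg hB, hζ]
      rw [e, norm_sub_rev]
      exact mul_le_mul_of_nonneg_left hTe (by positivity)
    have t3 : ‖(B : ℂ) * (K1 : ℂ) * (ζ * ((I * c) ^ 2 * exp (I * ((σ * c : ℝ) : ℂ)) - (I * ν') ^ 2 * exp (I * ((σ * ν' : ℝ) : ℂ))))‖ ≤
        B * K1 * (Δ' * (c + |ν'| + |ν'| ^ 2)) := by
      rw [norm_mul, norm_mul, norm_mul, Complex.norm_natCast, hζ, one_mul, hBn]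
      exact mul_le_mul_of_nonneg_left hee (by positivity)
    have t4 : ‖ζh * (S - (K1 : ℂ) * (I * c) ^ 2 * T)‖ ≤ ((n : ℝ) + 2) ^ 3 * ‖ζh‖ := by
      rw [norm_mul, mul_comm]; exact mul_le_mul_of_nonneg_right hE (norm_nonneg _)
    have := add_le_add (add_le_add (add_le_add t1 t2) t3) t4
    refine this.trans (le_of_eq ?_)
    ring
  have hre := Complex.abs_re_le_norm (ζh * S - (B : ℂ) * (K1 : ℂ) * (ζ * (I * ν') ^ 2 * exp (I * ((σ * ν' : ℝ) : ℂ))))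
  rw [Complex.sub_re] at hre
  have e2 : ((B : ℂ) * (K1 : ℂ) * (ζ * (I * ν') ^ 2 * exp (I * ((σ * ν' : ℝ) : ℂ)))).re =
      B * K1 * (ζ * (I * ν') ^ 2 * exp (I * ((σ * ν' : ℝ) : ℂ))).re := by
    rw [show (B : ℂ) * (K1 : ℂ) = ((B * K1 : ℝ) : ℂ) by push_cast; ring, Complex.re_ofReal_mul]
  rw [e2] at hre
  exact hre.trans hnorm

/-! ### The one-sided third-order step of a true term -/

/-- **Third-order Taylor step of `Re(ζ e^{iωs})` in `s`**: for `|ωu| ≤ 2`,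
`Re(ζ e^{iω(s+u)}) ≥ Re(ζ e^{iωs}) + Re(ζ iω e^{iωs})·u + ½Re(ζ (iω)² e^{iωs})·u² − |ωu|³/3` (`‖ζ‖ = 1`). -/
theorem term_step3 {ζ : ℂ} (hζ : ‖ζ‖ = 1) (ω s u : ℝ) (hu : |ω * u| ≤ 2) :
    (ζ * exp (I * ((ω * s : ℝ) : ℂ))).re + (ζ * (I * ω) * exp (I * ((ω * s : ℝ) : ℂ))).re * u +
        (ζ * (I * ω) ^ 2 * exp (I * ((ω * s : ℝ) : ℂ))).re / 2 * u ^ 2 - |ω * u| ^ 3 / 3 ≤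
      (ζ * exp (I * ((ω * (s + u) : ℝ) : ℂ))).re := by
  set x : ℂ := I * ((ω * u : ℝ) : ℂ) with hx
  have hxn : ‖x‖ = |ω * u| := by rw [hx, norm_mul, Complex.norm_I, one_mul, Complex.norm_real, Real.norm_eq_abs]
  have hb : ‖x‖ / ((3 : ℕ).succ : ℝ) ≤ 1 / 2 := by
    rw [hxn]; push_cast
    rw [div_le_div_iff₀ (by norm_num) (by norm_num)]; linarith
  have hR := Complex.exp_bound' (n := 3) hb
  have hsum : ∑ m ∈ range 3, x ^ m / (m.factorial : ℂ) = 1 + x + x ^ 2 / 2 := by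
    simp [Finset.sum_range_succ, Nat.factorial]
  rw [hsum, hxn] at hR
  have hfac : ((3 : ℕ).factorial : ℝ) = 6 := by norm_num [Nat.factorial]
  rw [hfac] at hR
  -- e^{iω(s+u)} = e^{iωs}·(1 + x + x²/2) + e^{iωs}·R
  set R : ℂ := exp x - (1 + x + x ^ 2 / 2) with hRdef
  have hsplit : ζ * exp (I * ((ω * (s + u) : ℝ) : ℂ)) =
      ζ * exp (I * ((ω * s : ℝ) : ℂ)) * (1 + x + x ^ 2 / 2) + ζ * exp (I * ((ω * s : ℝ) : ℂ)) * R := by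
    rw [hRdef, hx]
    have : exp (I * ((ω * (s + u) : ℝ) : ℂ)) = exp (I * ((ω * s : ℝ) : ℂ)) * exp (I * ((ω * u : ℝ) : ℂ)) := by
      rw [← Complex.exp_add]; push_cast; ring_nf
    rw [this]; ring
  have hre_poly : (ζ * exp (I * ((ω * s : ℝ) : ℂ)) * (1 + x + x ^ 2 / 2)).re =
      (ζ * exp (I * ((ω * s : ℝ) : ℂ))).re + (ζ * (I * ω) * exp (I * ((ω * s : ℝ) : ℂ))).re * u +
        (ζ * (I * ω) ^ 2 * exp (I * ((ω * s : ℝ) : ℂ))).re / 2 * u ^ 2 := by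
    rw [hx]
    have e1 : ζ * exp (I * ((ω * s : ℝ) : ℂ)) * (1 + I * ((ω * u : ℝ) : ℂ) + (I * ((ω * u : ℝ) : ℂ)) ^ 2 / 2) =
        ζ * exp (I * ((ω * s : ℝ) : ℂ)) + (ζ * (I * ω) * exp (I * ((ω * s : ℝ) : ℂ))) * (u : ℂ) +
          (ζ * (I * ω) ^ 2 * exp (I * ((ω * s : ℝ) : ℂ))) * ((u ^ 2 / 2 : ℝ) : ℂ) := by push_cast; ring
    rw [e1, Complex.add_re, Complex.add_re, Complex.re_mul_ofReal, Complex.re_mul_ofReal]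
    ring
  have hrem : |(ζ * exp (I * ((ω * s : ℝ) : ℂ)) * R).re| ≤ |ω * u| ^ 3 / 3 := by
    refine (Complex.abs_re_le_norm _).trans ?_
    rw [norm_mul, norm_mul, hζ, one_mul, Complex.norm_exp_I_mul_ofReal, one_mul]
    linarith
  rw [hsplit, Complex.add_re, hre_poly]
  have := (abs_le.1 hrem).1
  linarith

end Summit.RiemannHypothesis.RiemannHypothesis.Theorems.IntegerScrew.Manifest.Fast
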